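import Summits.QuantumFields.YangMills.Theses.UnitScaleTilt
import Literature.MathematicalPhysics.QuantumFieldTheory.Balaban1983to89.T3PrintedRegularMinimiser
import Literature.MathematicalPhysics.QuantumFieldTheory.Balaban1983to89.T3SmallLiftHistory
import Literature.MathematicalPhysics.QuantumFieldTheory.Balaban1983to89.T3AlphaInputsAC
import Summits.QuantumFields.YangMills.Theorems.UnitScaleTiltFluctuationComparisonRegPrOneStepSubmersion
import Summits.QuantumFields.YangMills.Theorems.UnitScaleTiltFluctuationComparisonRegPrSocket
import HarnessLib

/-!
# BC3 birth skeleton v5b PROPOSAL (fleet lead ★ym-ust-19201-p2, 2026-08-26T16:0xZ; = v5 46923b947a6dbaa4 with the side condition STRENGTHENED to `GoodData` per finding 0364c67c41f82510 — needs `T3AlphaInputsAC` §6, p455927, for the route owner's registration; owner ruling g15-№1 (4)) —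
# crux `FluctuationComparisonRegPr` (route `UnitScaleTilt`, item stmt-QuantumFields-19201, K1bR-pr): STUB 3 `stub_logComparisonRegPr` RE-CUT
# THROUGH THE LANDED α INTERFACE `T3AlphaInputsAC` (p452599) AND THE LANDED SOCKET THEOREM `LogComparisonSocket.logComparisonRegPr_of_exists_data` (p452026)

= v4 (8bc2245c3551c7ca: `stub_oneStepSmallLift` byte-identical, `landed_oneStepSubmersion`, composition byte-identical) with `stub_logComparisonRegPr`
now a THEOREM from two registered stubs over the α interface:

* `stub_localRepOfLane` (XXL; IN PRINT FOR ONE RUN modulo the (α) inputs: [Balaban1985UV3] Thm 2 = (41)∧(47) at the trivial history for the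
  `ℰp`-pinned densities, with the interaction data LOCAL and SIZED, i.e. [Balaban1988Convergent]'s complete small-field expansion; = owner's
  «common pair» `stub_laneInputsT3 ∧ stub_alphaOfLane` MERGED until alpha-1's Summit-side `AtScaleT3AC` name exists — then split it by name, the
  composition below does not change): below a regularity threshold `ε₁(L)` and a coupling threshold `γ₁(L, ε₀, b₀, p₀)`, every family carries
  SOME `D : AlphaDataT3 F γ` with `IsLocal D`, `TermSize D b₀ p₀ C κ₁` for some constants, `Sizes D b₀ p₀`, and the two-sided representation at
  the heights `RepAtHeights D b₀ p₀ ε₀` (= ★p2's socket `TwoSidedRepAt` at `PintH/EcstH/RmH`).  consumes: every field of `D` the schemas name;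
  `D` may depend on `(ε₀, b₀, p₀)` (print's decomposition of unity uses the profile).
* `stub_cauchyOfLocalRep` (XXL, located-UNPRINTED for non-abelian d = 3 — [King1986] Thm 3.4 shape GIVEN local sized representations of both
  runs; = owner's S-E′): below thresholds of the same shape, with `m₀ = m₀(L, ε₀)` BEFORE `b₀ p₀ F γ D` (the registered «∃ m₀»; S-B's `m > 1 + β/γ′`
  with exponents functions of `L`), EVERY local sized datum with the two-sided representation satisfies `CauchyAtHeights D b₀ p₀ m` (= ★p2's socket
  `PintCauchyAt` at `PintH D`).  consumes: `IsLocal`, `TermSize`, `RepAtHeights` as hypotheses (rigidity, ★p1 g1 p452861: without locality the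
  statement would be the whole stub), `CauchyAtHeights` as conclusion.
`stub_logComparisonRegPr` := `logComparisonRegPr_of_exists_data PintH EcstH RmH Good stub_localRepOfLane stub_cauchyOfLocalRep` with
`Good D ε₀ b₀ p₀ := IsLocal D ∧ (∃ C κ₁, TermSize D b₀ p₀ C κ₁) ∧ Sizes D b₀ p₀` — NO sorry below §1; `FluctuationComparisonRegPr_of` byte-identical to v4.
Probes to run before registration (owner): stub → crux ×3, stub → `YM3TorusSU2` ×3, stub outright ×3 (trivial witnesses: `D` with `Pterm = 0`
fails `RepAtHeights`; `Rm := 0` data fail `IsLocal`-free? — no: locality is a property of `Pterm`, the envelope of `PintH`; a datum with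
`Pint := log ρ + bg` is NOT local, which is the point of the cut).
-/

set_option autoImplicit false

noncomputable section

namespace Summit.QuantumFields.YangMills.Cruxes.FluctuationComparisonRegPr.BirthV5b

open MeasureTheory Filter Topology
open Literature.MathematicalPhysics.QuantumFieldTheory.Balaban1983to89
open Literature.MathematicalPhysics.QuantumFieldTheory.Balaban1983to89.T3ContinuumYM3Torus
open Literature.MathematicalPhysics.QuantumFieldTheory.Balaban1983to89.T3LevelShift
open Literature.MathematicalPhysics.QuantumFieldTheory.Balaban1983to89.T3UnitLawDensityEML (ℰp measurableE_ℰp)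
open Literature.MathematicalPhysics.QuantumFieldTheory.Balaban1983to89.T3UnitScaleTilt
open Literature.MathematicalPhysics.QuantumFieldTheory.Balaban1983to89.T3RestrictedUnitDensity
open Literature.MathematicalPhysics.QuantumFieldTheory.Balaban1983to89.T3TiltDescent
open Literature.MathematicalPhysics.QuantumFieldTheory.Balaban1983to89.T3ConstrainedMinimiser
open Literature.MathematicalPhysics.QuantumFieldTheory.Balaban1983to89.T3RegularMinimiser
open Literature.MathematicalPhysics.QuantumFieldTheory.Balaban1983to89.T3PrintedRegularMinimiser
open Literature.MathematicalPhysics.QuantumFieldTheory.Balaban1983to89.T3SmallLiftHistory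
open Literature.MathematicalPhysics.QuantumFieldTheory.Balaban1983to89.T3LogComparisonSocket
open Literature.MathematicalPhysics.QuantumFieldTheory.Balaban1983to89.T3AlphaInputsAC
open Literature.MathematicalPhysics.QuantumFieldTheory.Balaban1983to89.Missing
open Literature.MathematicalPhysics.QuantumFieldTheory.Balaban1983to89.T4Continuum

/-! ## §0 The side condition «good data» (v1.1 anti-junk clauses of `T3AlphaInputsAC` §6, finding 0364c67c41f82510): print's objects pinned -/

/-- **GOOD (41)-DATA**: the interaction sum is the sum of its localised terms (`PintDecomp`, (43)), each term gauge invariant ((26)) and local on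
print's enlargement `X̃` of its domain (`IsLocal` ∧ `EnlBounded`, p.263; big blocks of size `M₁ = 2`, radius `r = 2` — any fixed numbers serve the
anti-junk purpose, print's are absorbed in the constants), the composite minimiser at the trivial history IS print's minimiser over (6)(ε₀)
(`UminTrivIsRegMinimiser`, [7] Thm 1 (8)), the characteristic functions contain the route's window (`AdmOnSmall`, (47)), the printed sizes hold
(`TermSize` (44) with summable domains `LocCover` (45), `Regularity68` (68), `Sizes` = (41)/(46)/(65)).  With these clauses «∃ D, GoodData D ∧
RepAtHeights D» is Bałaban's small-field representation theorem and NOT satisfiable by the junk datum `Pterm := (log ρ + bg) ∘ avg^j`. -/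
def GoodData {F : T3Family} {γ : ℝ} (D : AlphaDataT3 F γ) (ε₀ b₀ p₀ : ℝ) : Prop :=
  PintDecomp D ∧ IsLocal D ∧ EnlBounded D 2 2 ∧ GaugeInv26 D ∧ UminTrivIsRegMinimiser D b₀ p₀ ε₀ ∧ AdmOnSmall D b₀ p₀ ∧
    (∃ C κ₁ : ℝ, TermSize D b₀ p₀ C κ₁ ∧ ∃ C' : ℝ, LocCover D κ₁ C') ∧ (∃ C68 : ℝ, Regularity68 D b₀ p₀ C68) ∧ Sizes D b₀ p₀

/-! ## §1 Registered stubs (sorries live ONLY here) -/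

/-- STUB 1 (L; W7) — ONE-STEP SMALL LIFT with gain `κ√L ≤ 1` for every family of block size `L` (linearisation certified; non-linear step =
implicit function on `SU(2)^{bonds}`). [cite: Balaban1987RG1, (0.4)/(0.18) p.253] -/
theorem stub_oneStepSmallLift :
    ∀ L : ℕ, ∃ κ δ₀ : ℝ, κ * Real.sqrt L ≤ 1 ∧ 0 < δ₀ ∧
      ∀ F : T3Family, F.L = L → OneStepSmallLift F ℰp κ δ₀ := by
  sorry

/-- LANDED (was STUB 2 of v3, `stub_oneStepSubmersion`): the ONE-STEP SUBMERSION (O) ∧ (N) of the (0.4)/EML averaging on small `SU(2)`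
fields — PROVED by the fleet lead ym-ust-19201-p1, `Theorems.OneStepSubmersion.oneStepSubmersion_family` (p446430; engines p443878 fibrewise
submersion, p444734/p445163 parametric IFT on `SU(2)` in the cone picture, p445817 analytic datum of the EML fibre map).  Renamed `landed_…` so the
registrar does not resurrect it as a stub (cf. 19200 v3d). [cite: Balaban1987RG1, (0.4) p.253] -/
theorem landed_oneStepSubmersion :
    ∀ L : ℕ, ∃ δ₁ : ℝ, 0 < δ₁ ∧ ∀ F : T3Family, F.L = L → ∀ K j : ℕ, j + 1 ≤ F.m + K →
      (∀ O : Set (GaugeField (F.P K) j (Matrix.specialUnitaryGroup (Fin 2) ℂ)), IsOpen O → O ⊆ {U | PlaqSmall δ₁ U} →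
        IsOpen ((BlockAveraging.blockAvg (P := F.P K) (j := j) ℰp).avg '' O)) ∧
      (∀ O : Set (GaugeField (F.P K) j (Matrix.specialUnitaryGroup (Fin 2) ℂ)), IsOpen O → O ⊆ {U | PlaqSmall δ₁ U} →
        ∀ A : Set (GaugeField (F.P K) (j + 1) (Matrix.specialUnitaryGroup (Fin 2) ℂ)), MeasurableSet A →
          fieldMeasure (F.P K) j (Matrix.specialUnitaryGroup (Fin 2) ℂ)
              (O ∩ (BlockAveraging.blockAvg (P := F.P K) (j := j) ℰp).avg ⁻¹' A) = 0 →
            fieldMeasure (F.P K) (j + 1) (Matrix.specialUnitaryGroup (Fin 2) ℂ)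
              (A ∩ (BlockAveraging.blockAvg (P := F.P K) (j := j) ℰp).avg '' O) = 0) :=
  Summit.QuantumFields.YangMills.Theorems.OneStepSubmersion.oneStepSubmersion_family

/-- STUB 3a (XXL; in print for ONE run modulo the (α) inputs — [Balaban1985UV3] Thm 2 p.272 = (41) p.266 ∧ (47) p.267 at the trivial history, data
local (25)/(35) and sized (44)–(46), for the `ℰp`-pinned densities; [Balaban1988Convergent] §2; = the owner's pair `stub_laneInputsT3 ∧ stub_alphaOfLane`
merged until `AtScaleT3AC` is named) — A LOCAL, SIZED TWO-SIDED SMALL-FIELD REPRESENTATION EXISTS for every family below the thresholds.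
[cite: Balaban1985UV3, Thm 2 p.272; Balaban1988Convergent, §0 p.244] -/
theorem stub_localRepOfLane :
    ∀ (L : ℕ), Odd L → 1 < L →
      ∃ ε₁ : ℝ, 0 < ε₁ ∧ ∀ (ε₀ : ℝ), 0 < ε₀ → ε₀ ≤ ε₁ → ∀ (b₀ p₀ : ℝ), 0 < b₀ → 2 < p₀ →
        ∃ γ₁ : ℝ, 0 < γ₁ ∧ ∀ (F : T3Family) (γ : ℝ), F.L = L → 0 < γ → γ ≤ γ₁ →
          ∃ D : AlphaDataT3 F γ,
            GoodData D ε₀ b₀ p₀ ∧ RepAtHeights D b₀ p₀ ε₀ := by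
  sorry

/-- STUB 3b (HARDEST, XXL, located-UNPRINTED for non-abelian d = 3; [King1986] Thm 3.4 (3.9) p.656 GIVEN the local sized representations of both
runs; = the owner's S-E′ `stub_cauchyOfLocalRep`) — EVERY LOCAL SIZED DATUM WITH THE TWO-SIDED REPRESENTATION IS CUT-OFF-CAUCHY at the free fractions
`m ≥ m₀(L, ε₀)`. [cite: King1986, Thm 3.4 (3.9) p.656] -/
theorem stub_cauchyOfLocalRep :
    ∀ (L : ℕ), Odd L → 1 < L →
      ∃ ε₁ : ℝ, 0 < ε₁ ∧ ∀ (ε₀ : ℝ), 0 < ε₀ → ε₀ ≤ ε₁ → ∃ m₀ : ℕ, ∀ (m : ℕ), m₀ ≤ m → ∀ (b₀ p₀ : ℝ), 0 < b₀ → 2 < p₀ →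
        ∃ γ₁ : ℝ, 0 < γ₁ ∧ ∀ (F : T3Family) (γ : ℝ), F.L = L → 0 < γ → γ ≤ γ₁ →
          ∀ D : AlphaDataT3 F γ,
            GoodData D ε₀ b₀ p₀ → RepAtHeights D b₀ p₀ ε₀ → CauchyAtHeights D b₀ p₀ m := by
  sorry

/-! ## §2 The composition — NO sorry below this line; v2–v4's STUB 3 `stub_logComparisonRegPr` (text byte-identical) is now the THEOREM `logComparisonRegPr` (renamed so the registrar does not resurrect it as a stub, cf. 19200 v3d) -/

/-- The registered STUB 3 of v2–v4, `stub_logComparisonRegPr` (888 chars, byte-identical statement), now a THEOREM from stubs 3a + 3b by the LANDED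
socket theorem `LogComparisonSocket.logComparisonRegPr_of_exists_data` (p452026; data type `AlphaDataT3`, readings `PintH/EcstH/RmH`, side
condition `IsLocal ∧ TermSize ∧ Sizes`). [cite: King1986, Thm 3.4 (3.9) p.656] -/
theorem logComparisonRegPr :
    ∀ (L : ℕ), Odd L → 1 < L →
      ∃ ε₁ : ℝ, 0 < ε₁ ∧ ∀ (ε₀ : ℝ), 0 < ε₀ → ε₀ ≤ ε₁ → ∃ m₀ : ℕ, ∀ (m : ℕ), m₀ ≤ m → ∀ (b₀ p₀ : ℝ), 0 < b₀ → 2 < p₀ →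
        ∃ γ₁ : ℝ, 0 < γ₁ ∧ ∀ (F : T3Family) (γ : ℝ), F.L = L → 0 < γ → γ ≤ γ₁ →
          ∃ (r κ : ℕ → ℝ), Summable r ∧ (∀ K, 0 ≤ r K) ∧
            ∀ K, ∀ᵐ V ∂fieldMeasure (F.P (K / m)) 0 (Matrix.specialUnitaryGroup (Fin 2) ℂ),
              PlaqSmall (θBal F.L γ b₀ p₀ (K / m)) V →
                0 < heightDensity F γ (Nat.div_le_self K m) (histGood F ℰp (θBal F.L γ b₀ p₀) K (K / m)) V →
                0 < heightDensity F γ ((Nat.div_le_self K m).trans (Nat.le_succ K))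
                      (histGood F ℰp (θBal F.L γ b₀ p₀) (K + 1) (K / m)) V →
                  |(Real.log (heightDensity F γ ((Nat.div_le_self K m).trans (Nat.le_succ K))
                        (histGood F ℰp (θBal F.L γ b₀ p₀) (K + 1) (K / m)) V) + bgRegPr' F γ m ε₀ K V) -
                    (Real.log (heightDensity F γ (Nat.div_le_self K m) (histGood F ℰp (θBal F.L γ b₀ p₀) K (K / m)) V) + bgRegPr F γ m ε₀ K V) -
                      κ K| ≤ r K :=
  Summit.QuantumFields.YangMills.Theorems.LogComparisonSocket.logComparisonRegPr_of_exists_data (Δ := AlphaDataT3)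
    (fun D => D.PintH) (fun D => D.EcstH) (fun D => D.RmH)
    (fun {F} {γ} (D : AlphaDataT3 F γ) ε₀ b₀ p₀ => GoodData D ε₀ b₀ p₀)
    stub_localRepOfLane stub_cauchyOfLocalRep

/-- The old registered `stub_posOnSmall` (birth 04793f26c2da46ec), now a THEOREM modulo stub 1 ALONE (statement verbatim; «Lemma B» landed). -/
theorem posOnSmall :
    ∀ (L m : ℕ), 0 < m → ∀ (b₀ p₀ : ℝ), 0 < b₀ → 2 < p₀ → ∃ γ₁ : ℝ, 0 < γ₁ ∧
      ∀ (F : T3Family) (γ : ℝ), F.L = L → 0 < γ → γ ≤ γ₁ →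
        ∀ K, ∀ᵐ V ∂fieldMeasure (F.P (K / m)) 0 (Matrix.specialUnitaryGroup (Fin 2) ℂ),
          PlaqSmall (θBal F.L γ b₀ p₀ (K / m)) V →
            0 < heightDensity F γ (Nat.div_le_self K m) (histGood F ℰp (θBal F.L γ b₀ p₀) K (K / m)) V ∧
            0 < heightDensity F γ ((Nat.div_le_self K m).trans (Nat.le_succ K))
                  (histGood F ℰp (θBal F.L γ b₀ p₀) (K + 1) (K / m)) V :=
  Summit.QuantumFields.YangMills.Theorems.PosOnSmallReduction.posOnSmall_of_smallLift_of_oneStepSubmersion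
    stub_oneStepSmallLift landed_oneStepSubmersion

/-- **`FluctuationComparisonRegPr ⇐ stub_oneStepSmallLift ∧ stub_localRepOfLane ∧ stub_cauchyOfLocalRep`** (+ landed p446430 ∘ p443013 ∘ p428548 for positivity; p452026 for the fluctuation comparison). -/
theorem FluctuationComparisonRegPr_of : Summit.QuantumFields.YangMills.Theses.UnitScaleTilt.FluctuationComparisonRegPr := by
  intro L
  by_cases hL : Odd L ∧ 1 < L
  · obtain ⟨ε₁, hε₁, hε⟩ := logComparisonRegPr L hL.1 hL.2
    refine ⟨ε₁, hε₁, fun ε₀ h0 h1 => ?_⟩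
    obtain ⟨m₀, hm₀⟩ := hε ε₀ h0 h1
    refine ⟨max m₀ 1, fun m hm b₀ p₀ hb hp => ?_⟩
    have hm₀' : m₀ ≤ m := (le_max_left _ _).trans hm
    have hmpos : 0 < m := Nat.lt_of_lt_of_le Nat.one_pos ((le_max_right _ _).trans hm)
    obtain ⟨γa, hγa, ha⟩ := posOnSmall L m hmpos b₀ p₀ hb hp
    obtain ⟨γb, hγb, hb'⟩ := hm₀ m hm₀' b₀ p₀ hb hp
    refine ⟨min γa γb, lt_min hγa hγb, fun F γ hFL hγ hγ₁ => ?_⟩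
    have hP := ha F γ hFL hγ (hγ₁.trans (min_le_left _ _))
    obtain ⟨r, κ, hr, hr0, hC⟩ := hb' F γ hFL hγ (hγ₁.trans (min_le_right _ _))
    refine ⟨r, κ, hr, hr0, fun K => ?_⟩
    filter_upwards [hP K, hC K] with V hVp hVc
    intro hs
    obtain ⟨h0', h1'⟩ := hVp hs
    exact ⟨h0', h1', hVc hs h0' h1'⟩
  · refine ⟨1, one_pos, fun ε₀ _ _ => ⟨0, fun m _ b₀ p₀ _ _ => ⟨1, one_pos, fun F γ hFL _ _ => ?_⟩⟩⟩
    have hF := F.hL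
    rw [hFL] at hF
    exact (hL hF).elim

end Summit.QuantumFields.YangMills.Cruxes.FluctuationComparisonRegPr.BirthV5b

end
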